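import Summits.CriticalPhenomena.PercolationContinuityZ3.Theorems.Transplant.FKConnectivityAllQPat3Levels
import Summits.CriticalPhenomena.PercolationContinuityZ3.Theorems.Transplant.FKConnectivityAllQAntipodalMinorDefs
import HarnessLib

/-!
# Connectivity correlation inequalities for `φ_{w,q}`, every `q > 0` — levelwise values WITH A CONTRACTED SET (groundwork for
# THEOREM 3C's minor steps, Stage S3/S4)

Definitions file (`--supports stmt-CriticalPhenomena-4575`), census lane `prim-bschramm-census` (gen 36) of the post-continuity programme (LANE 2 bschramm, FK sub-lane);
builds on p205010 (kernel theorem, internal audit signed; external expert review pending).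
No named facts, no sorries; standard axioms.  THEOREM 3C's degree reductions (series / pendant laws) and Lemma Θ₃'s
minimal-counterexample induction run over MINORS; in fk-2's vocabulary (`…AntipodalMinorDefs.lean`) a minor `H / C \ D` is the
pair (free edges, contracted set `C` open in both members of the antipodal pair) — no quotient vertex type.  This file fixes the
corresponding functionals: `FK.tvalC`, **`FK.lev2C E C x y s F μ`** (patterns `pat3 (γ ∪ C)`, `pat3 ((E \ γ) ∪ C)`, exponent
`FK.apExpC`), with `FK.apExpC_empty` / `FK.tvalC_empty` / `FK.lev2C_empty` (for `C = ∅` they are `tval` / `lev2`) and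
`FK.lev2C_nonneg_of_coef`.  The C-versions of the gluing laws (`…Pat3Gluing`, `…ThetaGluing`, `…CornerGluing`, …) are the next
step (census g36 memo §23).
[cite: Grimmett2006, §1.4 eq. (1.20) (p. 15); §3.8 (pp. 61–62)]
-/

noncomputable section

namespace Summit.CriticalPhenomena.PercolationContinuityZ3.Theorems

namespace FK

open SimpleGraph Literature.Probability.LatticeModels Literature.Probability.Percolation

/-! ### Levelwise values WITH A CONTRACTED SET (groundwork for THEOREM 3C's minor steps; census g36 memo §23(a)) -/

section Contracted

open scoped Classical

variable {V : Type*}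

/-- **Weighted one-level evaluation of the minor `· / C`**: `tvalC w E C x y s t = Σ_{γ ⊆ E} w(apExpC E C γ) · t(pat3 (γ ∪ C),
pat3 ((E \ γ) ∪ C))` — the contracted set `C` is open in BOTH members of the antipodal pair (fk-2's `FK.apExpC`; no quotient
vertex type). For `C = ∅` this is `FK.tval`. [cite: Grimmett2006, §1.4 eq. (1.20) (p. 15)] -/
noncomputable def tvalC (w : ℕ → ℝ) (E C : Finset (Sym2 V)) (x y s : V) (t : Pat3 → Pat3 → ℤ) : ℝ :=
  ∑ γ ∈ E.powerset, w (apExpC E C γ) * (t (pat3 (γ ∪ C) x y s) (pat3 (E \ γ ∪ C) x y s) : ℝ)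

/-- **Levelwise value of a two-level table on the minor `· / C`** (`FK.lev2` with the contracted set riding along). [folklore] -/
noncomputable def lev2C (E C : Finset (Sym2 V)) (x y s : V) (F : ℕ → Pat3 → Pat3 → ℤ) (μ : ℕ) : ℤ :=
  ∑ γ ∈ E.powerset, ((if apExpC E C γ = μ then F 0 (pat3 (γ ∪ C) x y s) (pat3 (E \ γ ∪ C) x y s) else 0) +
    (if apExpC E C γ + 1 = μ then F 1 (pat3 (γ ∪ C) x y s) (pat3 (E \ γ ∪ C) x y s) else 0))

/-- With nothing contracted the exponent is the antipodal exponent. [folklore] -/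
theorem apExpC_empty (E γ : Finset (Sym2 V)) : apExpC E ∅ γ = apExp E γ := by
  unfold apExpC apExp
  rw [Finset.union_empty, Finset.union_empty]

/-- With nothing contracted `tvalC` is `tval`. [folklore] -/
theorem tvalC_empty (w : ℕ → ℝ) (E : Finset (Sym2 V)) (x y s : V) (t : Pat3 → Pat3 → ℤ) :
    tvalC w E ∅ x y s t = tval w E x y s t := by
  unfold tvalC tval
  refine Finset.sum_congr rfl fun γ _ => ?_
  rw [apExpC_empty, Finset.union_empty, Finset.union_empty]

/-- With nothing contracted `lev2C` is `lev2`. [folklore] -/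
theorem lev2C_empty (E : Finset (Sym2 V)) (x y s : V) (F : ℕ → Pat3 → Pat3 → ℤ) (μ : ℕ) :
    lev2C E ∅ x y s F μ = lev2 E x y s F μ := by
  unfold lev2C lev2
  refine Finset.sum_congr rfl fun γ _ => ?_
  rw [apExpC_empty, Finset.union_empty, Finset.union_empty]

/-- A two-level table with nonnegative coefficients is levelwise nonnegative on every minor. [folklore] -/
theorem lev2C_nonneg_of_coef (E C : Finset (Sym2 V)) (x y s : V) {F : ℕ → Pat3 → Pat3 → ℤ} (hF : ∀ c P Q, 0 ≤ F c P Q)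
    (μ : ℕ) : 0 ≤ lev2C E C x y s F μ := by
  unfold lev2C
  refine Finset.sum_nonneg fun γ _ => add_nonneg ?_ ?_ <;> split_ifs <;> first | exact hF _ _ _ | exact le_rfl

end Contracted

end FK

end Summit.CriticalPhenomena.PercolationContinuityZ3.Theorems

end
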